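import Literature.Probability.Percolation.AdjFourArmCyclic
import HarnessLib

/-!
# Four arms landed on ARCS of the hexagons: the host event of the adjacent Thm. 27 (definitions and structure)

Topic `Literature/Probability/Percolation`; family `crit-perc`. Definitions with bodies and proofs
(no named fact). Serves the named fact `Literature.Probability.Percolation.Werner2009_lemma63`
(Werner 2009, Lecture 6, Lemma 6.3 for the tree's ORDER-FREE `π̂_t`) through P. Nolin,
*Near-critical percolation in two dimensions*, EJP 13 (2008), §6.2, proof of Thm. 27
[arXiv 0711.4948: Thm. 26] for the ADJACENT arrangement `σ = BBWW`. Nolin (step 2 and Case 3 of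
that proof): "we impose the landing areas of the different arms on `∂S_{2^K}`, ie we fix some
landing sequence `I'` and we consider the event `Ā^{./I'}_{j,σ}` … We group consecutive arms of
the same color in 'packs' … and replace the condition '`r_i ⇝ I_i` for all `i_q ≤ i ≤ i_q+l_q-1`'
by '`r_i ⇝ Ĩ_q`' … an event `Ã = Ã⁺ ∩ Ã⁻` … This new definition allows to use Menger's theorem".
Here, for `j = 4`, `σ = BBWW`, the pack landing areas are ARCS of two consecutive sides of the
hexagons (`hexSector`, `AdjFourArmCyclic.lean`): the two open arms land on the arc `a` (sides
`a, a+1`), the two closed ones on the arc `b`; and the landing is imposed at BOTH ends (Nolin's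
`Ā^{I/I'}`), which is what types the inner pieces of the arms in the proof
(`mem_adjFourArmCyc_of_innerLanded`).

* `arcPair c a r R` — two disjoint arms of colour `c` across `{r ≤ |·|_𝕋 ≤ R}` from the arc `a`
  of `∂Λ_r` to the arc `a` of `∂Λ_R` (increasing for `c = open`, decreasing for `c = closed`);
* `arcFourArm a b r R` — **the host**: two disjoint open arms arc `a` → arc `a` and two disjoint
  closed arms arc `b` → arc `b`; `arcFourArm_eq_inter` (`= arcPair true a ∩ arcPair false b`);
* `innerArcFourArm a b r R`, `outerArcFourArm a b r R` — the same with the landing imposed at the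
  inner, resp. outer, end only (the events of the inner and outer PIECES of the host's arms);
* inclusions: `arcFourArm ⊆ innerArcFourArm ∩ outerArcFourArm ⊆ armEvent ![T,F,T,F]`,
  `innerArcFourArm_anti` (truncation at the first visit of a smaller outer hexagon keeps the inner
  landing), `outerArcFourArm_mono_left` (final segments keep the outer landing), hence
  `arcFourArm_subset_innerArcFourArm`, `arcFourArm_subset_outerArcFourArm` across radii;
* typing: `innerArcFourArm 0 3 ⊆ adjFourArmCyc`, `outerArcFourArm 0 3 ⊆ adjFourArmCyc` (and the
  arcs `3, 0` by complementation) — the pieces are cyclically adjacent;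
* locality (`…_determined`, `determinedBy_…`, measurability) and colour flip
  (`compl_preimage_arcFourArm : compl ⁻¹' arcFourArm a b = arcFourArm b a`, likewise inner/outer).

## References

* P. Nolin, Near-critical percolation in two dimensions, *Electron. J. Probab.* 13 (2008), §4.2
  (Def. 8: landing sequences, the events `Ā^{I/I'}`), §6.2 proof of Thm. 27, step 2 and Case 3
  [arXiv 0711.4948: Def. 7, Thm. 26] [Nolin2008].
* H. Kesten, Scaling relations for 2D-percolation, *Comm. Math. Phys.* 109 (1987), §2
  (arms with prescribed landing) [KestenScalingCMP1987].

## Mathlib / tree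

Tree: `hexSector`, `adjFourArmCyc`, `mem_adjFourArmCyc_of_innerLanded`,
`mem_adjFourArmCyc_of_outerLanded`, `compl_preimage_adjFourArmCyc` (`AdjFourArmCyclic.lean`),
`hexSide`, `image_rot_hexSide` (`LandedAltFourArm.lean`), `armEvent`, `IsColouredPath`,
`isColouredPath_compl_iff`, `vecTFTF_succ`, `disjoint_support_of_isColouredPath`,
`mem_triAnnulus_of_arm`, `triWalkTruncAt` and its spec lemmas (`ArmEventsProofs.lean`).
-/

noncomputable section

open Set

namespace Literature.Probability.Percolation

open LatticeModels

/-! ### The events -/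

/-- **Two disjoint arms of colour `c` between the arcs `a`** (sides `a, a+1`) of `∂Λ_r` and of
`∂Λ_R`, across `{r ≤ |·|_𝕋 ≤ R}` — one pack of Nolin's `Ã⁺` / `Ã⁻` with landing at both ends. [cite: Nolin2008, §4.2 Def. 8 and §6.2 proof of Thm. 27, Case 3 (arXiv 0711.4948: Def. 7, Thm. 26: packs and Ã = Ã⁺ ∩ Ã⁻)] -/
def arcPair (c : Bool) (a r R : ℕ) : Set (SiteConfig (Site 2)) :=
  {ω | ∃ (x y : Fin 2 → Site 2) (w : ∀ j, triGraph.Walk (x j) (y j)),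
    (∀ j, x j ∈ triSphere r ∧ y j ∈ triSphere R ∧ (w j).IsPath ∧
      (∀ v ∈ (w j).support, v ∈ (↑(triBall R) : Set (Site 2)) \ ↑(triBall r) ∨ v ∈ triSphere r) ∧
      IsColouredPath ω c (w j)) ∧
    (Pairwise fun i j => Disjoint (w i).support.toFinset (w j).support.toFinset) ∧
    (∀ j, x j ∈ hexSector r a ∧ y j ∈ hexSector R a)}

/-- **The host event: four arms landed on arcs at both ends.** Two disjoint open arms from the
arc `a` of `∂Λ_r` to the arc `a` of `∂Λ_R` and two disjoint closed arms from the arc `b` of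
`∂Λ_r` to the arc `b` of `∂Λ_R` (indices: `0, 2` open, `1, 3` closed, as in `armEvent ![T,F,T,F]`).
For `(a, b) = (0, 3)` the cyclic colour order is `BBWW` (Nolin's `Ā^{I/I'}_{4,BBWW}` with the pack
landing areas `Ĩ`). [cite: Nolin2008, §4.2 Def. 8 and §6.2 proof of Thm. 27, step 2 and Case 3 (arXiv 0711.4948: Def. 7, Thm. 26)] -/
def arcFourArm (a b r R : ℕ) : Set (SiteConfig (Site 2)) :=
  {ω | ∃ (x y : Fin 4 → Site 2) (w : ∀ j, triGraph.Walk (x j) (y j)),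
    (∀ j, x j ∈ triSphere r ∧ y j ∈ triSphere R ∧ (w j).IsPath ∧
      (∀ v ∈ (w j).support, v ∈ (↑(triBall R) : Set (Site 2)) \ ↑(triBall r) ∨ v ∈ triSphere r) ∧
      IsColouredPath ω (![true, false, true, false] j) (w j)) ∧
    (Pairwise fun i j => Disjoint (w i).support.toFinset (w j).support.toFinset) ∧
    (x 0 ∈ hexSector r a ∧ x 2 ∈ hexSector r a ∧ x 1 ∈ hexSector r b ∧ x 3 ∈ hexSector r b) ∧
    (y 0 ∈ hexSector R a ∧ y 2 ∈ hexSector R a ∧ y 1 ∈ hexSector R b ∧ y 3 ∈ hexSector R b)}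

/-- **Four arms landed on arcs at the INNER end** (the event of the inner pieces of the host's
arms). [cite: Nolin2008, §4.2 Def. 8 (arXiv 0711.4948: Def. 7: the landing sequence I on ∂S_n)] -/
def innerArcFourArm (a b r R : ℕ) : Set (SiteConfig (Site 2)) :=
  {ω | ∃ (x y : Fin 4 → Site 2) (w : ∀ j, triGraph.Walk (x j) (y j)),
    (∀ j, x j ∈ triSphere r ∧ y j ∈ triSphere R ∧ (w j).IsPath ∧
      (∀ v ∈ (w j).support, v ∈ (↑(triBall R) : Set (Site 2)) \ ↑(triBall r) ∨ v ∈ triSphere r) ∧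
      IsColouredPath ω (![true, false, true, false] j) (w j)) ∧
    (Pairwise fun i j => Disjoint (w i).support.toFinset (w j).support.toFinset) ∧
    (x 0 ∈ hexSector r a ∧ x 2 ∈ hexSector r a ∧ x 1 ∈ hexSector r b ∧ x 3 ∈ hexSector r b)}

/-- **Four arms landed on arcs at the OUTER end** (the event of the outer pieces of the host's
arms; for `(a, b) = (0, 3)` it contains the tree's `landedFourAdj`). [cite: Nolin2008, §4.2 Def. 8 (arXiv 0711.4948: Def. 7: the landing sequence I' on ∂S_N)] -/
def outerArcFourArm (a b r R : ℕ) : Set (SiteConfig (Site 2)) :=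
  {ω | ∃ (x y : Fin 4 → Site 2) (w : ∀ j, triGraph.Walk (x j) (y j)),
    (∀ j, x j ∈ triSphere r ∧ y j ∈ triSphere R ∧ (w j).IsPath ∧
      (∀ v ∈ (w j).support, v ∈ (↑(triBall R) : Set (Site 2)) \ ↑(triBall r) ∨ v ∈ triSphere r) ∧
      IsColouredPath ω (![true, false, true, false] j) (w j)) ∧
    (Pairwise fun i j => Disjoint (w i).support.toFinset (w j).support.toFinset) ∧
    (y 0 ∈ hexSector R a ∧ y 2 ∈ hexSector R a ∧ y 1 ∈ hexSector R b ∧ y 3 ∈ hexSector R b)}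

/-! ### Inclusions -/

/-- The host is inner-landed. [folklore] -/
theorem arcFourArm_subset_inner (a b r R : ℕ) : arcFourArm a b r R ⊆ innerArcFourArm a b r R := by
  rintro ω ⟨x, y, w, hw, hd, hx, -⟩; exact ⟨x, y, w, hw, hd, hx⟩

/-- The host is outer-landed. [folklore] -/
theorem arcFourArm_subset_outer (a b r R : ℕ) : arcFourArm a b r R ⊆ outerArcFourArm a b r R := by
  rintro ω ⟨x, y, w, hw, hd, -, hy⟩; exact ⟨x, y, w, hw, hd, hy⟩

/-- Inner-landed arms are arms. [folklore] -/
theorem innerArcFourArm_subset_armEvent (a b r R : ℕ) :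
    innerArcFourArm a b r R ⊆ armEvent ![true, false, true, false] r R := by
  rintro ω ⟨x, y, w, hw, hd, -⟩; exact ⟨x, y, w, hw, hd⟩

/-- Outer-landed arms are arms. [folklore] -/
theorem outerArcFourArm_subset_armEvent (a b r R : ℕ) :
    outerArcFourArm a b r R ⊆ armEvent ![true, false, true, false] r R := by
  rintro ω ⟨x, y, w, hw, hd, -⟩; exact ⟨x, y, w, hw, hd⟩

/-- The host event is a four-arm event. [folklore] -/
theorem arcFourArm_subset_armEvent (a b r R : ℕ) :
    arcFourArm a b r R ⊆ armEvent ![true, false, true, false] r R :=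
  (arcFourArm_subset_inner a b r R).trans (innerArcFourArm_subset_armEvent a b r R)

/-! ### The events from paths inside site sets -/

/-- Sites of an arc lie on the sphere. [folklore] -/
theorem hexSector_subset_triSphere (K i : ℕ) : hexSector K i ⊆ (↑(triSphere K) : Set (Site 2)) :=
  fun _ hz => Finset.mem_coe.2 (mem_triSphere_iff.2 (triNorm_of_mem_hexSector hz))

/-- **A pack from paths** (as `mem_armEvent_of_pathIn`): two disjoint subsets of the closed
annulus of colour `c`, each containing a `𝕋`-path from the arc `a` of `∂Λ_r` to the arc `a` of
`∂Λ_R`, put `ω` in `arcPair c a r R`. [cite: SmirnovWernerMRL2001, §3] [cite: Nolin2008, §4.2 Def. 8 (arXiv 0711.4948: Def. 7)] -/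
theorem mem_arcPair_of_pathIn (c : Bool) {a r R : ℕ} {ω : SiteConfig (Site 2)}
    (T : Fin 2 → Set (Site 2)) (hT : Pairwise fun i j => Disjoint (T i) (T j))
    (hcol : ∀ i, ∀ z ∈ T i, (z ∈ ω ↔ c = true))
    (hann : ∀ i, ∀ z ∈ T i, (r : ℤ) ≤ triNorm z ∧ triNorm z ≤ R)
    (hp : ∀ i, ∃ x ∈ hexSector r a, ∃ y ∈ hexSector R a, PathIn triGraph (T i) x y) :
    ω ∈ arcPair c a r R := by
  classical
  choose x hx y hy hpath using hp
  have hw : ∀ i, ∃ W : triGraph.Walk (x i) (y i), ∀ z ∈ W.support, z ∈ T i :=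
    fun i => (hpath i).exists_walk
  choose W hW using hw
  refine ⟨x, y, fun i => ((W i).toPath : triGraph.Walk (x i) (y i)), fun i => ?_, ?_, fun i =>
    ⟨hx i, hy i⟩⟩
  · have hsub : ∀ z ∈ ((W i).toPath : triGraph.Walk (x i) (y i)).support, z ∈ T i :=
      fun z hz => hW i z (SimpleGraph.Walk.support_toPath_subset_support (W i) hz)
    refine ⟨hexSector_subset_triSphere r a (hx i), hexSector_subset_triSphere R a (hy i),
      (W i).toPath.2, fun z hz => ?_, fun z hz => ?_⟩
    · obtain ⟨h1, h2⟩ := hann i z (hsub z hz)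
      rcases eq_or_lt_of_le h1 with h1 | h1
      · right; rw [mem_triSphere_iff, ← h1]
      · left
        simp only [mem_sdiff, Finset.mem_coe, mem_triBall_iff, not_le]
        exact ⟨h2, h1⟩
    · have := hcol i z (hsub z hz)
      simpa using this
  · intro i j hij
    rw [Finset.disjoint_left]
    intro z hzi hzj
    have hi := hW i z (SimpleGraph.Walk.support_toPath_subset_support (W i) (List.mem_toFinset.1 hzi))
    have hj := hW j z (SimpleGraph.Walk.support_toPath_subset_support (W j) (List.mem_toFinset.1 hzj))
    exact Set.disjoint_left.1 (hT hij) hi hj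

/-- The arc of the `j`-th arm: `a` for the open arms `j = 0, 2`, `b` for the closed arms
`j = 1, 3`. [folklore] -/
def arcOf (a b : ℕ) : Fin 4 → ℕ := ![a, b, a, b]

/-- **The host from paths** (as `mem_armEvent_of_pathIn`): four pairwise disjoint subsets of the
closed annulus of colours `T,F,T,F`, the `j`-th containing a `𝕋`-path from the arc `arcOf a b j`
of `∂Λ_r` to the same arc of `∂Λ_R`, put `ω` in `arcFourArm a b r R`. [cite: SmirnovWernerMRL2001, §3] [cite: Nolin2008, §4.2 Def. 8 (arXiv 0711.4948: Def. 7)] -/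
theorem mem_arcFourArm_of_pathIn {a b r R : ℕ} {ω : SiteConfig (Site 2)}
    (T : Fin 4 → Set (Site 2)) (hT : Pairwise fun i j => Disjoint (T i) (T j))
    (hcol : ∀ i, ∀ z ∈ T i, (z ∈ ω ↔ (![true, false, true, false] : Fin 4 → Bool) i = true))
    (hann : ∀ i, ∀ z ∈ T i, (r : ℤ) ≤ triNorm z ∧ triNorm z ≤ R)
    (hp : ∀ i, ∃ x ∈ hexSector r (arcOf a b i), ∃ y ∈ hexSector R (arcOf a b i),
      PathIn triGraph (T i) x y) :
    ω ∈ arcFourArm a b r R := by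
  classical
  choose x hx y hy hpath using hp
  have hw : ∀ i, ∃ W : triGraph.Walk (x i) (y i), ∀ z ∈ W.support, z ∈ T i :=
    fun i => (hpath i).exists_walk
  choose W hW using hw
  refine ⟨x, y, fun i => ((W i).toPath : triGraph.Walk (x i) (y i)), fun i => ?_, ?_,
    ⟨hx 0, hx 2, hx 1, hx 3⟩, ⟨hy 0, hy 2, hy 1, hy 3⟩⟩
  · have hsub : ∀ z ∈ ((W i).toPath : triGraph.Walk (x i) (y i)).support, z ∈ T i :=
      fun z hz => hW i z (SimpleGraph.Walk.support_toPath_subset_support (W i) hz)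
    refine ⟨hexSector_subset_triSphere r _ (hx i), hexSector_subset_triSphere R _ (hy i),
      (W i).toPath.2, fun z hz => ?_, fun z hz => ?_⟩
    · obtain ⟨h1, h2⟩ := hann i z (hsub z hz)
      rcases eq_or_lt_of_le h1 with h1 | h1
      · right; rw [mem_triSphere_iff, ← h1]
      · left
        simp only [mem_sdiff, Finset.mem_coe, mem_triBall_iff, not_le]
        exact ⟨h2, h1⟩
    · have := hcol i z (hsub z hz)
      simpa using this
  · intro i j hij
    rw [Finset.disjoint_left]
    intro z hzi hzj
    have hi := hW i z (SimpleGraph.Walk.support_toPath_subset_support (W i) (List.mem_toFinset.1 hzi))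
    have hj := hW j z (SimpleGraph.Walk.support_toPath_subset_support (W j) (List.mem_toFinset.1 hzj))
    exact Set.disjoint_left.1 (hT hij) hi hj

/-! ### Colour flip exchanges the arcs -/

section Compl

variable {a b r R : ℕ}

/-- Complementation maps `innerArcFourArm a b` into `innerArcFourArm b a` (arms `j ↦ w (j + 1)`,
as `compl_mem_altFourArm`). [cite: SmirnovWernerMRL2001, Rem. 2] -/
theorem compl_mem_innerArcFourArm {ω : SiteConfig (Site 2)} (hω : ω ∈ innerArcFourArm a b r R) :
    ωᶜ ∈ innerArcFourArm b a r R := by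
  obtain ⟨x, y, w, hw, hdisj, hx0, hx2, hx1, hx3⟩ := hω
  refine ⟨fun j => x (j + 1), fun j => y (j + 1), fun j => w (j + 1), fun j => ?_, ?_, ?_⟩
  · obtain ⟨hx, hy, hpath, hsupp, hcol⟩ := hw (j + 1)
    refine ⟨hx, hy, hpath, hsupp, ?_⟩
    rw [isColouredPath_compl_iff, ← vecTFTF_succ]
    exact hcol
  · intro i j hij
    exact hdisj fun h => hij (by simpa using h)
  · exact ⟨by simpa using hx1, by simpa using hx3, by simpa using hx2, by simpa using hx0⟩

/-- Complementation maps `outerArcFourArm a b` into `outerArcFourArm b a`. [cite: SmirnovWernerMRL2001, Rem. 2] -/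
theorem compl_mem_outerArcFourArm {ω : SiteConfig (Site 2)} (hω : ω ∈ outerArcFourArm a b r R) :
    ωᶜ ∈ outerArcFourArm b a r R := by
  obtain ⟨x, y, w, hw, hdisj, hy0, hy2, hy1, hy3⟩ := hω
  refine ⟨fun j => x (j + 1), fun j => y (j + 1), fun j => w (j + 1), fun j => ?_, ?_, ?_⟩
  · obtain ⟨hx, hy, hpath, hsupp, hcol⟩ := hw (j + 1)
    refine ⟨hx, hy, hpath, hsupp, ?_⟩
    rw [isColouredPath_compl_iff, ← vecTFTF_succ]
    exact hcol
  · intro i j hij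
    exact hdisj fun h => hij (by simpa using h)
  · exact ⟨by simpa using hy1, by simpa using hy3, by simpa using hy2, by simpa using hy0⟩

/-- Complementation maps `arcFourArm a b` into `arcFourArm b a`. [cite: SmirnovWernerMRL2001, Rem. 2] -/
theorem compl_mem_arcFourArm {ω : SiteConfig (Site 2)} (hω : ω ∈ arcFourArm a b r R) :
    ωᶜ ∈ arcFourArm b a r R := by
  obtain ⟨x, y, w, hw, hdisj, ⟨hx0, hx2, hx1, hx3⟩, hy0, hy2, hy1, hy3⟩ := hω
  refine ⟨fun j => x (j + 1), fun j => y (j + 1), fun j => w (j + 1), fun j => ?_, ?_, ?_, ?_⟩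
  · obtain ⟨hx, hy, hpath, hsupp, hcol⟩ := hw (j + 1)
    refine ⟨hx, hy, hpath, hsupp, ?_⟩
    rw [isColouredPath_compl_iff, ← vecTFTF_succ]
    exact hcol
  · intro i j hij
    exact hdisj fun h => hij (by simpa using h)
  · exact ⟨by simpa using hx1, by simpa using hx3, by simpa using hx2, by simpa using hx0⟩
  · exact ⟨by simpa using hy1, by simpa using hy3, by simpa using hy2, by simpa using hy0⟩

/-- `compl ⁻¹' innerArcFourArm a b r R = innerArcFourArm b a r R`. [cite: SmirnovWernerMRL2001, Rem. 2] -/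
theorem compl_preimage_innerArcFourArm (a b r R : ℕ) :
    compl ⁻¹' innerArcFourArm a b r R = innerArcFourArm b a r R := by
  ext ω
  refine ⟨fun h => ?_, fun h => compl_mem_innerArcFourArm h⟩
  have := compl_mem_innerArcFourArm (ω := ωᶜ) h
  rwa [compl_compl] at this

/-- `compl ⁻¹' outerArcFourArm a b r R = outerArcFourArm b a r R`. [cite: SmirnovWernerMRL2001, Rem. 2] -/
theorem compl_preimage_outerArcFourArm (a b r R : ℕ) :
    compl ⁻¹' outerArcFourArm a b r R = outerArcFourArm b a r R := by
  ext ω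
  refine ⟨fun h => ?_, fun h => compl_mem_outerArcFourArm h⟩
  have := compl_mem_outerArcFourArm (ω := ωᶜ) h
  rwa [compl_compl] at this

/-- `compl ⁻¹' arcFourArm a b r R = arcFourArm b a r R`. [cite: SmirnovWernerMRL2001, Rem. 2] -/
theorem compl_preimage_arcFourArm (a b r R : ℕ) :
    compl ⁻¹' arcFourArm a b r R = arcFourArm b a r R := by
  ext ω
  refine ⟨fun h => ?_, fun h => compl_mem_arcFourArm h⟩
  have := compl_mem_arcFourArm (ω := ωᶜ) h
  rwa [compl_compl] at this

end Compl

/-! ### The pieces are cyclically adjacent -/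

/-- **Inner-landed arms with opens on the arc `0` and closeds on the arc `3` are cyclically
adjacent** (`2 ≤ r ≤ R`; `mem_adjFourArmCyc_of_innerLanded`). [cite: Nolin2008, §4.1–4.2 (arXiv 0711.4948: A_{4,BBWW} and the landing sequences)] -/
theorem innerArcFourArm_subset_adjFourArmCyc {r R : ℕ} (hr : 2 ≤ r) (hrR : r ≤ R) :
    innerArcFourArm 0 3 r R ⊆ adjFourArmCyc r R := by
  obtain ⟨K, rfl⟩ : ∃ K, r = K + 1 := ⟨r - 1, by omega⟩
  rintro ω ⟨x, y, w, hw, hdisj, hx0, hx2, hx1, hx3⟩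
  exact mem_adjFourArmCyc_of_innerLanded (by omega) hrR hw hdisj hx0 hx2 hx1 hx3

/-- The same with the arcs exchanged (by complementation). [cite: Nolin2008, §4.1 (WBWB and BWBW are the same sequence)] -/
theorem innerArcFourArm_subset_adjFourArmCyc' {r R : ℕ} (hr : 2 ≤ r) (hrR : r ≤ R) :
    innerArcFourArm 3 0 r R ⊆ adjFourArmCyc r R := by
  intro ω hω
  have h := innerArcFourArm_subset_adjFourArmCyc hr hrR (compl_mem_innerArcFourArm hω)
  have h' := compl_mem_adjFourArmCyc (by omega) h
  rwa [compl_compl] at h'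

/-- **Outer-landed arms with opens on the arc `0` and closeds on the arc `3` are cyclically
adjacent** (`1 ≤ R`; `mem_adjFourArmCyc_of_outerLanded`). [cite: Nolin2008, §4.1–4.2 (arXiv 0711.4948: A_{4,BBWW} and the landing sequences)] -/
theorem outerArcFourArm_subset_adjFourArmCyc {r R : ℕ} (hR : 1 ≤ R) :
    outerArcFourArm 0 3 r R ⊆ adjFourArmCyc r R := by
  rintro ω ⟨x, y, w, hw, hdisj, hy0, hy2, hy1, hy3⟩
  exact mem_adjFourArmCyc_of_outerLanded hR hw hdisj hy0 hy2 hy1 hy3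

/-- The same with the arcs exchanged (by complementation). [cite: Nolin2008, §4.1 (WBWB and BWBW are the same sequence)] -/
theorem outerArcFourArm_subset_adjFourArmCyc' {r R : ℕ} (hR : 1 ≤ R) :
    outerArcFourArm 3 0 r R ⊆ adjFourArmCyc r R := by
  intro ω hω
  have h := outerArcFourArm_subset_adjFourArmCyc (r := r) hR (compl_mem_outerArcFourArm hω)
  have h' := compl_mem_adjFourArmCyc hR h
  rwa [compl_compl] at h'

/-! ### Changing the radii -/

/-- **Truncation at the first visit of a smaller outer hexagon keeps the inner landing**
(`r ≤ R ≤ R'`; as `altFourArm_anti`). [cite: SmirnovWernerMRL2001, §3] [cite: Nolin2008, §4.1] -/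
theorem innerArcFourArm_anti (a b r : ℕ) {R R' : ℕ} (hr : r ≤ R) (hR : R ≤ R') :
    innerArcFourArm a b r R' ⊆ innerArcFourArm a b r R := by
  intro ω hω
  obtain ⟨x, y, w, hw, hdisj, hx⟩ := hω
  refine ⟨x, fun j => (triWalkTruncAt R (w j)).1, fun j => (triWalkTruncAt R (w j)).2,
    fun j => ?_, ?_, hx⟩
  · obtain ⟨hx, hy, hpath, hsupp, hcol⟩ := hw j
    have hxn : triNorm (x j) = r := mem_triSphere_iff.1 hx
    have hyn : triNorm (y j) = R' := mem_triSphere_iff.1 hy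
    obtain ⟨hend, hle⟩ := triWalkTruncAt_spec_up (R : ℤ) (w j) (by omega) (by omega)
    refine ⟨hx, mem_triSphere_iff.2 hend, isPath_triWalkTruncAt _ hpath, fun v hv => ?_,
      fun v hv => hcol v (support_triWalkTruncAt_subset _ _ hv)⟩
    have hvR : triNorm v ≤ R := hle v hv
    rcases hsupp v (support_triWalkTruncAt_subset _ _ hv) with hv' | hv'
    · left
      simp only [Set.mem_sdiff, Finset.mem_coe, mem_triBall_iff] at hv' ⊢
      exact ⟨hvR, hv'.2⟩
    · exact Or.inr hv'
  · intro i j hij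
    refine Finset.disjoint_left.2 fun v hvi hvj => ?_
    exact Finset.disjoint_left.1 (hdisj hij)
      (List.mem_toFinset.2 (support_triWalkTruncAt_subset _ _ (List.mem_toFinset.1 hvi)))
      (List.mem_toFinset.2 (support_triWalkTruncAt_subset _ _ (List.mem_toFinset.1 hvj)))

/-- **The final segments after the last visit of a larger inner hexagon keep the outer landing**
(`r ≤ r' ≤ R`; as `altFourArm_mono_left`). [cite: SmirnovWernerMRL2001, §3] [cite: Nolin2008, §4.1] -/
theorem outerArcFourArm_mono_left (a b : ℕ) {r r' R : ℕ} (hr : r ≤ r') (hR : r' ≤ R) :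
    outerArcFourArm a b r R ⊆ outerArcFourArm a b r' R := by
  classical
  intro ω hω
  obtain ⟨x, y, w, hw, hdisj, hy⟩ := hω
  have hsub : ∀ l, ∀ v, v ∈ (triWalkTruncAt (r' : ℤ) (w l).reverse).2.reverse.support →
      v ∈ (w l).support := by
    intro l v hv
    rw [SimpleGraph.Walk.support_reverse, List.mem_reverse] at hv
    have := support_triWalkTruncAt_subset _ _ hv
    rwa [SimpleGraph.Walk.support_reverse, List.mem_reverse] at this
  refine ⟨fun j => (triWalkTruncAt r' (w j).reverse).1, y,
    fun j => (triWalkTruncAt r' (w j).reverse).2.reverse, fun j => ?_, ?_, hy⟩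
  · obtain ⟨hx, hy, hpath, hsupp, hcol⟩ := hw j
    have hxn : triNorm (x j) = r := mem_triSphere_iff.1 hx
    have hyn : triNorm (y j) = R := mem_triSphere_iff.1 hy
    obtain ⟨hend, hge⟩ := triWalkTruncAt_spec_down (r' : ℤ) (w j).reverse (by omega) (by omega)
    refine ⟨mem_triSphere_iff.2 hend, hy, ?_, fun v hv => ?_, fun v hv => hcol v (hsub j v hv)⟩
    · exact (isPath_triWalkTruncAt _ hpath.reverse).reverse
    · have hv' : (r' : ℤ) ≤ triNorm v := by
        apply hge
        rw [SimpleGraph.Walk.support_reverse, List.mem_reverse] at hv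
        exact hv
      have hvR : triNorm v ≤ R :=
        (mem_triAnnulus.1 (mem_triAnnulus_of_arm (hr.trans hR) (hsupp v (hsub j v hv)))).2
      rcases eq_or_lt_of_le hv' with h | h
      · right
        rw [mem_triSphere_iff, ← h]
      · left
        simp only [Set.mem_sdiff, Finset.mem_coe, mem_triBall_iff, not_le]
        exact ⟨hvR, h⟩
  · intro i j hij
    refine Finset.disjoint_left.2 fun v hvi hvj => ?_
    exact Finset.disjoint_left.1 (hdisj hij)
      (List.mem_toFinset.2 (hsub i v (List.mem_toFinset.1 hvi)))
      (List.mem_toFinset.2 (hsub j v (List.mem_toFinset.1 hvj)))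

/-- The host restricted to a smaller outer radius is inner-landed there. [cite: Nolin2008, §6.2, proof of Thm. 27 (the inner annulus)] -/
theorem arcFourArm_subset_innerArcFourArm {a b r R R' : ℕ} (hr : r ≤ R) (hR : R ≤ R') :
    arcFourArm a b r R' ⊆ innerArcFourArm a b r R :=
  (arcFourArm_subset_inner a b r R').trans (innerArcFourArm_anti a b r hr hR)

/-- The host restricted to a larger inner radius is outer-landed there. [cite: Nolin2008, §6.2, proof of Thm. 27 (the outer annulus)] -/
theorem arcFourArm_subset_outerArcFourArm {a b r r' R : ℕ} (hr : r ≤ r') (hR : r' ≤ R) :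
    arcFourArm a b r R ⊆ outerArcFourArm a b r' R :=
  (arcFourArm_subset_outer a b r R).trans (outerArcFourArm_mono_left a b hr hR)

/-! ### Locality and measurability -/

section Locality

variable {a b r R : ℕ}

/-- `innerArcFourArm` is determined by the sites of the annulus. [cite: SmirnovWernerMRL2001, §3] -/
theorem innerArcFourArm_determined (hrR : r ≤ R) (ω ω' : SiteConfig (Site 2))
    (h : ∀ v ∈ triAnnulus r R, (v ∈ ω ↔ v ∈ ω')) :
    ω ∈ innerArcFourArm a b r R ↔ ω' ∈ innerArcFourArm a b r R := by
  constructor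
  · rintro ⟨x, y, w, hw, hdisj, hl⟩
    refine ⟨x, y, w, fun j => ?_, hdisj, hl⟩
    obtain ⟨hx, hy, hpath, hsupp, hcol⟩ := hw j
    exact ⟨hx, hy, hpath, hsupp, fun v hv =>
      (h v (mem_triAnnulus_of_arm hrR (hsupp v hv))).symm.trans (hcol v hv)⟩
  · rintro ⟨x, y, w, hw, hdisj, hl⟩
    refine ⟨x, y, w, fun j => ?_, hdisj, hl⟩
    obtain ⟨hx, hy, hpath, hsupp, hcol⟩ := hw j
    exact ⟨hx, hy, hpath, hsupp, fun v hv =>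
      (h v (mem_triAnnulus_of_arm hrR (hsupp v hv))).trans (hcol v hv)⟩

/-- `outerArcFourArm` is determined by the sites of the annulus. [cite: SmirnovWernerMRL2001, §3] -/
theorem outerArcFourArm_determined (hrR : r ≤ R) (ω ω' : SiteConfig (Site 2))
    (h : ∀ v ∈ triAnnulus r R, (v ∈ ω ↔ v ∈ ω')) :
    ω ∈ outerArcFourArm a b r R ↔ ω' ∈ outerArcFourArm a b r R := by
  constructor
  · rintro ⟨x, y, w, hw, hdisj, hl⟩
    refine ⟨x, y, w, fun j => ?_, hdisj, hl⟩
    obtain ⟨hx, hy, hpath, hsupp, hcol⟩ := hw j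
    exact ⟨hx, hy, hpath, hsupp, fun v hv =>
      (h v (mem_triAnnulus_of_arm hrR (hsupp v hv))).symm.trans (hcol v hv)⟩
  · rintro ⟨x, y, w, hw, hdisj, hl⟩
    refine ⟨x, y, w, fun j => ?_, hdisj, hl⟩
    obtain ⟨hx, hy, hpath, hsupp, hcol⟩ := hw j
    exact ⟨hx, hy, hpath, hsupp, fun v hv =>
      (h v (mem_triAnnulus_of_arm hrR (hsupp v hv))).trans (hcol v hv)⟩

/-- `arcFourArm` is determined by the sites of the annulus. [cite: SmirnovWernerMRL2001, §3] -/
theorem arcFourArm_determined (hrR : r ≤ R) (ω ω' : SiteConfig (Site 2))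
    (h : ∀ v ∈ triAnnulus r R, (v ∈ ω ↔ v ∈ ω')) :
    ω ∈ arcFourArm a b r R ↔ ω' ∈ arcFourArm a b r R := by
  constructor
  · rintro ⟨x, y, w, hw, hdisj, hl, hl'⟩
    refine ⟨x, y, w, fun j => ?_, hdisj, hl, hl'⟩
    obtain ⟨hx, hy, hpath, hsupp, hcol⟩ := hw j
    exact ⟨hx, hy, hpath, hsupp, fun v hv =>
      (h v (mem_triAnnulus_of_arm hrR (hsupp v hv))).symm.trans (hcol v hv)⟩
  · rintro ⟨x, y, w, hw, hdisj, hl, hl'⟩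
    refine ⟨x, y, w, fun j => ?_, hdisj, hl, hl'⟩
    obtain ⟨hx, hy, hpath, hsupp, hcol⟩ := hw j
    exact ⟨hx, hy, hpath, hsupp, fun v hv =>
      (h v (mem_triAnnulus_of_arm hrR (hsupp v hv))).trans (hcol v hv)⟩

/-- From `…_determined` to `DeterminedBy`. [folklore] -/
theorem determinedBy_of_determined {E : Set (SiteConfig (Site 2))} {F : Finset (Site 2)}
    (hE : ∀ ω ω' : SiteConfig (Site 2), (∀ v ∈ F, (v ∈ ω ↔ v ∈ ω')) → (ω ∈ E ↔ ω' ∈ E)) :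
    DeterminedBy E ↑F := by
  rw [determinedBy_iff]
  intro ω ω' h
  refine hE ω ω' fun v hv => ?_
  have hv' : v ∈ (↑F : Set (Site 2)) := Finset.mem_coe.2 hv
  have key := Set.ext_iff.1 h v
  exact ⟨fun hω => (key.1 ⟨hω, hv'⟩).1, fun hω' => (key.2 ⟨hω', hv'⟩).1⟩

/-- `innerArcFourArm` is determined by `triAnnulus r R`. [cite: SmirnovWernerMRL2001, §3] -/
theorem determinedBy_innerArcFourArm (hrR : r ≤ R) :
    DeterminedBy (innerArcFourArm a b r R) ↑(triAnnulus r R) :=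
  determinedBy_of_determined (innerArcFourArm_determined hrR)

/-- `outerArcFourArm` is determined by `triAnnulus r R`. [cite: SmirnovWernerMRL2001, §3] -/
theorem determinedBy_outerArcFourArm (hrR : r ≤ R) :
    DeterminedBy (outerArcFourArm a b r R) ↑(triAnnulus r R) :=
  determinedBy_of_determined (outerArcFourArm_determined hrR)

/-- `arcFourArm` is determined by `triAnnulus r R`. [cite: SmirnovWernerMRL2001, §3] -/
theorem determinedBy_arcFourArm (hrR : r ≤ R) :
    DeterminedBy (arcFourArm a b r R) ↑(triAnnulus r R) :=
  determinedBy_of_determined (arcFourArm_determined hrR)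

/-- Measurability of the three events. [cite: SmirnovWernerMRL2001, §3] -/
theorem measurableSet_innerArcFourArm (hrR : r ≤ R) : MeasurableSet (innerArcFourArm a b r R) :=
  (determinedBy_innerArcFourArm hrR).measurableSet_of_finset

/-- Measurability of the three events. [cite: SmirnovWernerMRL2001, §3] -/
theorem measurableSet_outerArcFourArm (hrR : r ≤ R) : MeasurableSet (outerArcFourArm a b r R) :=
  (determinedBy_outerArcFourArm hrR).measurableSet_of_finset

/-- Measurability of the three events. [cite: SmirnovWernerMRL2001, §3] -/
theorem measurableSet_arcFourArm (hrR : r ≤ R) : MeasurableSet (arcFourArm a b r R) :=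
  (determinedBy_arcFourArm hrR).measurableSet_of_finset

end Locality

/-! ### The host as the intersection of an increasing and a decreasing event -/

section UpperLower

variable {a b r R : ℕ}

/-- An open pack is an increasing event. [cite: Nolin2008, §6.2, proof of Thm. 27, Case 3 (Ã⁺)] -/
theorem isUpperSet_arcPair_true (a r R : ℕ) : IsUpperSet (arcPair true a r R) := by
  rintro ω ω' hle ⟨x, y, w, hw, hd, hl⟩
  refine ⟨x, y, w, fun j => ?_, hd, hl⟩
  obtain ⟨hx, hy, hp, hs, hc⟩ := hw j
  refine ⟨hx, hy, hp, hs, fun v hv => ?_⟩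
  have hvω : v ∈ ω := by simpa using hc v hv
  simpa using hle hvω

/-- A closed pack is a decreasing event. [cite: Nolin2008, §6.2, proof of Thm. 27, Case 3 (Ã⁻)] -/
theorem isLowerSet_arcPair_false (a r R : ℕ) : IsLowerSet (arcPair false a r R) := by
  rintro ω ω' hle ⟨x, y, w, hw, hd, hl⟩
  refine ⟨x, y, w, fun j => ?_, hd, hl⟩
  obtain ⟨hx, hy, hp, hs, hc⟩ := hw j
  refine ⟨hx, hy, hp, hs, fun v hv => ?_⟩
  have hvω : v ∉ ω := by simpa using hc v hv
  have : v ∉ ω' := fun h => hvω (hle h)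
  simpa using this

/-- The index map merging an open pack (indices `0, 2`) and a closed pack (indices `1, 3`). [folklore] -/
def packIdx : Fin 2 ⊕ Fin 2 ≃ Fin 4 where
  toFun := Sum.elim ![0, 2] ![1, 3]
  invFun := ![Sum.inl 0, Sum.inr 0, Sum.inl 1, Sum.inr 1]
  left_inv := by rintro (i | i) <;> fin_cases i <;> rfl
  right_inv := by intro j; fin_cases j <;> rfl

/-- **The host is `Ã⁺ ∩ Ã⁻`**: `arcFourArm a b r R = arcPair true a r R ∩ arcPair false b r R`
(arms of different colours are disjoint automatically). [cite: Nolin2008, §6.2, proof of Thm. 27, Case 3 ("We construct in this way an event Ã = Ã⁺ ∩ Ã⁻")] -/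
theorem arcFourArm_eq_inter (a b r R : ℕ) :
    arcFourArm a b r R = arcPair true a r R ∩ arcPair false b r R := by
  ext ω
  constructor
  · rintro ⟨x, y, w, hw, hdisj, ⟨hx0, hx2, hx1, hx3⟩, hy0, hy2, hy1, hy3⟩
    refine ⟨⟨fun i => x (packIdx (Sum.inl i)), fun i => y (packIdx (Sum.inl i)),
        fun i => w (packIdx (Sum.inl i)), fun i => ?_, ?_, fun i => ?_⟩,
      ⟨fun i => x (packIdx (Sum.inr i)), fun i => y (packIdx (Sum.inr i)),
        fun i => w (packIdx (Sum.inr i)), fun i => ?_, ?_, fun i => ?_⟩⟩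
    · obtain ⟨hx, hy, hp, hs, hc⟩ := hw (packIdx (Sum.inl i))
      refine ⟨hx, hy, hp, hs, ?_⟩
      fin_cases i <;> exact hc
    · intro i j hij
      exact hdisj fun h => hij (Sum.inl_injective (packIdx.injective h))
    · fin_cases i
      · exact ⟨hx0, hy0⟩
      · exact ⟨hx2, hy2⟩
    · obtain ⟨hx, hy, hp, hs, hc⟩ := hw (packIdx (Sum.inr i))
      refine ⟨hx, hy, hp, hs, ?_⟩
      fin_cases i <;> exact hc
    · intro i j hij
      exact hdisj fun h => hij (Sum.inr_injective (packIdx.injective h))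
    · fin_cases i
      · exact ⟨hx1, hy1⟩
      · exact ⟨hx3, hy3⟩
  · rintro ⟨⟨x₁, y₁, w₁, hw₁, hd₁, hl₁⟩, ⟨x₂, y₂, w₂, hw₂, hd₂, hl₂⟩⟩
    -- the merged family, indexed by the sum type
    let X : Fin 2 ⊕ Fin 2 → Site 2 := Sum.elim x₁ x₂
    let Y : Fin 2 ⊕ Fin 2 → Site 2 := Sum.elim y₁ y₂
    let W : ∀ s : Fin 2 ⊕ Fin 2, triGraph.Walk (X s) (Y s) := fun s =>
      Sum.rec (motive := fun s => triGraph.Walk (X s) (Y s)) (fun i => w₁ i) (fun i => w₂ i) s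
    let c : Fin 2 ⊕ Fin 2 → Bool := Sum.elim (fun _ => true) (fun _ => false)
    have hws : ∀ s, X s ∈ triSphere r ∧ Y s ∈ triSphere R ∧ (W s).IsPath ∧
        (∀ v ∈ (W s).support, v ∈ (↑(triBall R) : Set (Site 2)) \ ↑(triBall r) ∨ v ∈ triSphere r) ∧
        IsColouredPath ω (c s) (W s) := by
      rintro (i | i)
      · exact hw₁ i
      · exact hw₂ i
    have hds : Pairwise fun s t => Disjoint (W s).support.toFinset (W t).support.toFinset := by
      rintro (i | i) (j | j) hst
      · exact hd₁ fun h => hst (congrArg Sum.inl h)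
      · exact disjoint_support_of_isColouredPath (hw₁ i).2.2.2.2 (hw₂ j).2.2.2.2
      · exact (disjoint_support_of_isColouredPath (hw₁ j).2.2.2.2 (hw₂ i).2.2.2.2).symm
      · exact hd₂ fun h => hst (congrArg Sum.inr h)
    refine ⟨fun j => X (packIdx.symm j), fun j => Y (packIdx.symm j), fun j => W (packIdx.symm j),
      fun j => ?_, ?_, ?_, ?_⟩
    · obtain ⟨hx, hy, hp, hs, hcol⟩ := hws (packIdx.symm j)
      refine ⟨hx, hy, hp, hs, ?_⟩
      fin_cases j <;> exact hcol
    · intro i j hij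
      exact hds fun h => hij (packIdx.symm.injective h)
    · exact ⟨(hl₁ 0).1, (hl₁ 1).1, (hl₂ 0).1, (hl₂ 1).1⟩
    · exact ⟨(hl₁ 0).2, (hl₁ 1).2, (hl₂ 0).2, (hl₂ 1).2⟩

end UpperLower

end Literature.Probability.Percolation
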